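import Mathlib
import HarnessLib

/-!
# The three-kernel Riesz window and the early bulk window lemma
(line `Sketch` of crux `StaticAbelianSqueeze.UniformAbelianRegularity` = (R), item stmt-AtomisticToContinuum-13416; `--supports` file proving
the registered analysis stub `stub_earlyBulkWindow`; closes nothing)

Pure real analysis, no chain objects.  The exact three-kernel Riesz window
`χ(s) = 2(1−2s)₊² − 9(1−4s/3)₊² + 8(1−s)₊²` is `≡ 1` on `[0,½]`, `≡ 0` on `[1,∞)`, continuous, antitone, `[0,1]`-valued
(`window_*`), and against any bounded measurable `C` it is an exact combination of three order-2 Riesz means: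
`∫₀^τ χ(t/τ) C = 2R₂(τ/2) − 9R₂(3τ/4) + 8R₂(τ)`, `R₂(T) = ∫₀^T (1 − t/T)² C` (`window_riesz_decomp`).

**Early bulk window lemma (`early_bulk_window`, registered form `stub_earlyBulkWindow`).** If `|C| ≤ M`, the Riesz means
`R₂(τ) → Λ` (`τ → ∞`) and the Abel means `A(ν) = ∫₀^∞ e^{−νt} C → Λ` (`ν ↓ 0`) for one finite `Λ`, then for every `ε > 0` there is
`ν₁ > 0` such that for every `ν ∈ (0, ν₁]` there is `τ₁` with `|∫₀^τ χ(t/τ)(1 − e^{−νt}) C(t) dt| ≤ ε` for all `τ ≥ τ₁`.  Proof: the Riesz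
combination tends to `(2 − 9 + 8)Λ = Λ`, while `|∫₀^τ χ(t/τ) e^{−νt} C − A(ν)| ≤ 8M/(ν²τ) + 2M/(ν³τ)` because `χ(t/τ) = 1` for `t ≤ τ/2`.
This replaces the zero-mean window lemma + the spectral conjunct K4 of the rev-3 cut of (R): the bulk enters only through Abel and
Riesz-2 summability to a common value.

Provenance: written sorry-free by planner-cstrat-stmt-AtomisticToContinuum-12596-s2-0 (`Cruxes/AbelThermodynamicLimit/Lines/abel_summable_splice.lean`
@f427cf72cf92, attached to stmt-13416 13:07Z); landed verbatim (namespace/header adapted, docstrings added) by the line lead of stmt-13416 (c1).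
[folklore]
-/

noncomputable section

namespace Summit.AtomisticToContinuum.FouriersLaw.Theorems.UniformAbelianRegularity.AbelSummableSplice

open MeasureTheory Set Filter Topology

/-! ## The three-kernel Riesz window `χ(s) = 2(1−2s)₊² − 9(1−4s/3)₊² + 8(1−s)₊²` (a function symbol with its defining equation) -/

section Window

variable (χ : ℝ → ℝ)
  (hχ : ∀ s, χ s = 2 * (max (1 - 2 * s) 0) ^ 2 - 9 * (max (1 - 4 * s / 3) 0) ^ 2 + 8 * (max (1 - s) 0) ^ 2)
include hχ

/-- On `[0, ½]` (indeed for every `s ≤ ½`) the three-kernel window equals `1`. -/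
theorem window_eq_one {s : ℝ} (hs : s ≤ 1 / 2) : χ s = 1 := by
  rw [hχ, max_eq_left (by linarith), max_eq_left (by linarith), max_eq_left (by linarith)]
  ring

/-- On `[½, ¾]` the three-kernel window is the concave parabola `−1 + 8s − 8s²`. -/
theorem window_eq_mid₁ {s : ℝ} (hs : 1 / 2 ≤ s) (hs' : s ≤ 3 / 4) : χ s = -1 + 8 * s - 8 * s ^ 2 := by
  rw [hχ, max_eq_right (by linarith), max_eq_left (by linarith), max_eq_left (by linarith)]
  ring

/-- On `[¾, 1]` the three-kernel window is `8(1 − s)²`. -/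
theorem window_eq_mid₂ {s : ℝ} (hs : 3 / 4 ≤ s) (hs' : s ≤ 1) : χ s = 8 * (1 - s) ^ 2 := by
  rw [hχ, max_eq_right (by linarith), max_eq_right (by linarith), max_eq_left (by linarith)]
  ring

/-- For `s ≥ 1` the three-kernel window vanishes. -/
theorem window_eq_zero {s : ℝ} (hs : 1 ≤ s) : χ s = 0 := by
  rw [hχ, max_eq_right (by linarith), max_eq_right (by linarith), max_eq_right (by linarith)]
  ring

/-- The three-kernel window takes values in `[0, 1]`. -/
theorem window_mem_Icc (s : ℝ) : χ s ∈ Icc (0 : ℝ) 1 := by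
  rcases le_or_gt s (1 / 2) with h | h
  · rw [window_eq_one χ hχ h]; exact ⟨zero_le_one, le_rfl⟩
  rcases le_or_gt s (3 / 4) with h' | h'
  · rw [window_eq_mid₁ χ hχ h.le h']
    constructor <;> nlinarith
  rcases le_or_gt s 1 with h'' | h''
  · rw [window_eq_mid₂ χ hχ h'.le h'']
    constructor <;> nlinarith
  · rw [window_eq_zero χ hχ h''.le]; exact ⟨le_rfl, zero_le_one⟩

/-- The three-kernel window is antitone (non-increasing). -/
theorem window_antitone : Antitone χ := by
  intro a b hab
  show χ b ≤ χ a
  rcases le_or_gt b (1 / 2) with hb | hb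
  · rw [window_eq_one χ hχ hb, window_eq_one χ hχ (hab.trans hb)]
  rcases le_or_gt a (1 / 2) with ha | ha
  · rw [window_eq_one χ hχ ha]; exact (window_mem_Icc χ hχ b).2
  rcases le_or_gt 1 b with hb1 | hb1
  · rw [window_eq_zero χ hχ hb1]; exact (window_mem_Icc χ hχ a).1
  -- now `1/2 < a ≤ b < 1`
  rcases le_or_gt b (3 / 4) with hb' | hb'
  · rw [window_eq_mid₁ χ hχ hb.le hb', window_eq_mid₁ χ hχ ha.le (hab.trans hb')]
    nlinarith
  rcases le_or_gt (3 / 4) a with ha' | ha'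
  · rw [window_eq_mid₂ χ hχ hb'.le hb1.le, window_eq_mid₂ χ hχ ha' (hab.trans hb1.le)]
    nlinarith
  · rw [window_eq_mid₂ χ hχ hb'.le hb1.le, window_eq_mid₁ χ hχ ha.le ha'.le]
    nlinarith

/-- The three-kernel window is continuous and antitone (bundled: the window facts the composition consumes). -/
theorem window_continuous_antitone : Continuous χ ∧ Antitone χ := by
  refine ⟨?_, window_antitone χ hχ⟩
  rw [show χ = fun s => 2 * (max (1 - 2 * s) 0) ^ 2 - 9 * (max (1 - 4 * s / 3) 0) ^ 2 + 8 * (max (1 - s) 0) ^ 2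
    from funext hχ]
  have h1 : Continuous fun s : ℝ => max (1 - 2 * s) 0 := (continuous_const.sub (continuous_const.mul continuous_id)).max continuous_const
  have h2 : Continuous fun s : ℝ => max (1 - 4 * s / 3) 0 :=
    (continuous_const.sub ((continuous_const.mul continuous_id).div_const _)).max continuous_const
  have h3 : Continuous fun s : ℝ => max (1 - s) 0 := (continuous_const.sub continuous_id).max continuous_const
  exact ((continuous_const.mul (h1.pow 2)).sub (continuous_const.mul (h2.pow 2))).add (continuous_const.mul (h3.pow 2))

end Window

/-! ## Riesz pieces: a truncated kernel `(1 − t/T)₊²` inside a longer window is the order-2 Riesz mean at horizon `T` -/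

/-- A bounded measurable function is integrable on `(0, τ]`. -/
theorem integrableOn_Ioc_of_bounded {C : ℝ → ℝ} {M : ℝ} (hCm : Measurable C) (hM : ∀ t, |C t| ≤ M) (a τ : ℝ) :
    IntegrableOn C (Ioc a τ) :=
  Measure.integrableOn_of_bounded (M := M) measure_Ioc_lt_top.ne hCm.aestronglyMeasurable
    (Eventually.of_forall fun t => by rw [Real.norm_eq_abs]; exact hM t)

/-- Inside a longer window `(0, τ]`, the truncated kernel `(1 − t/T)₊²` against `C` is the order-2 Riesz mean of `C` at horizon `T ≤ τ`. -/
theorem riesz_piece {C : ℝ → ℝ} {τ T : ℝ} (hC : IntegrableOn C (Ioc 0 τ)) (hT : 0 < T) (hTτ : T ≤ τ) :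
    ∫ t in Ioc (0:ℝ) τ, (max (1 - t / T) 0) ^ 2 * C t = ∫ t in Ioc (0:ℝ) T, (1 - t / T) ^ 2 * C t := by
  have hk : Continuous fun t : ℝ => (max (1 - t / T) 0) ^ 2 := ((continuous_const.sub (continuous_id.div_const _)).max continuous_const).pow 2
  have hkb : ∀ t : ℝ, 0 ≤ t → ‖(max (1 - t / T) 0) ^ 2‖ ≤ 1 := fun t ht => by
    rw [Real.norm_eq_abs, abs_of_nonneg (sq_nonneg _)]
    have h0 : 0 ≤ max (1 - t / T) 0 := le_max_right _ _
    have h1 : max (1 - t / T) 0 ≤ 1 := max_le (by linarith [div_nonneg ht hT.le]) zero_le_one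
    nlinarith
  have hint : IntegrableOn (fun t => (max (1 - t / T) 0) ^ 2 * C t) (Ioc 0 τ) := by
    refine Integrable.bdd_mul hC hk.aestronglyMeasurable (c := 1) ?_
    exact (ae_restrict_iff' measurableSet_Ioc).2 (Eventually.of_forall fun t ht => hkb t ht.1.le)
  rw [← Ioc_union_Ioc_eq_Ioc hT.le hTτ, setIntegral_union (Ioc_disjoint_Ioc_of_le le_rfl) measurableSet_Ioc
    (hint.mono_set (Ioc_subset_Ioc_right hTτ)) (hint.mono_set (Ioc_subset_Ioc_left hT.le))]
  rw [setIntegral_eq_zero_of_forall_eq_zero (t := Ioc T τ) (fun t ht => by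
    rw [max_eq_right (by rw [sub_nonpos, le_div_iff₀ hT, one_mul]; exact ht.1.le), zero_pow two_ne_zero, zero_mul]), add_zero]
  refine setIntegral_congr_fun measurableSet_Ioc (fun t ht => ?_)
  rw [max_eq_left (by rw [sub_nonneg, div_le_one hT]; exact ht.2)]

/-- The three-kernel window against a bounded bulk function is an exact combination of three Riesz means. -/
theorem window_riesz_decomp (χ : ℝ → ℝ)
    (hχ : ∀ s, χ s = 2 * (max (1 - 2 * s) 0) ^ 2 - 9 * (max (1 - 4 * s / 3) 0) ^ 2 + 8 * (max (1 - s) 0) ^ 2)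
    {C : ℝ → ℝ} {M : ℝ} (hCm : Measurable C) (hM : ∀ t, |C t| ≤ M) {τ : ℝ} (hτ : 0 < τ) :
    ∫ t in Ioc (0:ℝ) τ, χ (t / τ) * C t =
      2 * (∫ t in Ioc (0:ℝ) (τ / 2), (1 - t / (τ / 2)) ^ 2 * C t)
        - 9 * (∫ t in Ioc (0:ℝ) (3 * τ / 4), (1 - t / (3 * τ / 4)) ^ 2 * C t)
        + 8 * (∫ t in Ioc (0:ℝ) τ, (1 - t / τ) ^ 2 * C t) := by
  have hC : IntegrableOn C (Ioc 0 τ) := integrableOn_Ioc_of_bounded hCm hM 0 τ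
  have hτ0 : τ ≠ 0 := hτ.ne'
  have e1 : ∀ t : ℝ, 1 - 2 * (t / τ) = 1 - t / (τ / 2) := fun t => by field_simp
  have e2 : ∀ t : ℝ, 1 - 4 * (t / τ) / 3 = 1 - t / (3 * τ / 4) := fun t => by field_simp
  have hpt : ∀ t : ℝ, χ (t / τ) * C t =
      2 * ((max (1 - t / (τ / 2)) 0) ^ 2 * C t) - 9 * ((max (1 - t / (3 * τ / 4)) 0) ^ 2 * C t)
        + 8 * ((max (1 - t / τ) 0) ^ 2 * C t) := fun t => by
    rw [hχ, e1 t, e2 t]; ring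
  -- integrability of the three pieces on `(0, τ]`
  have hpiece : ∀ T : ℝ, 0 < T → IntegrableOn (fun t => (max (1 - t / T) 0) ^ 2 * C t) (Ioc 0 τ) := by
    intro T hT
    have hk : Continuous fun t : ℝ => (max (1 - t / T) 0) ^ 2 := ((continuous_const.sub (continuous_id.div_const _)).max continuous_const).pow 2
    refine Integrable.bdd_mul hC hk.aestronglyMeasurable (c := 1) ?_
    refine (ae_restrict_iff' measurableSet_Ioc).2 (Eventually.of_forall fun t ht => ?_)
    rw [Real.norm_eq_abs, abs_of_nonneg (sq_nonneg _)]
    have h0 : 0 ≤ max (1 - t / T) 0 := le_max_right _ _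
    have h1 : max (1 - t / T) 0 ≤ 1 := max_le (by linarith [div_nonneg ht.1.le hT.le]) zero_le_one
    nlinarith
  have i1 : Integrable (fun t => 2 * ((max (1 - t / (τ / 2)) 0) ^ 2 * C t)) (volume.restrict (Ioc (0:ℝ) τ)) :=
    (hpiece (τ / 2) (by positivity)).const_mul 2
  have i2 : Integrable (fun t => 9 * ((max (1 - t / (3 * τ / 4)) 0) ^ 2 * C t)) (volume.restrict (Ioc (0:ℝ) τ)) :=
    (hpiece (3 * τ / 4) (by positivity)).const_mul 9
  have i3 : Integrable (fun t => 8 * ((max (1 - t / τ) 0) ^ 2 * C t)) (volume.restrict (Ioc (0:ℝ) τ)) :=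
    (hpiece τ hτ).const_mul 8
  have i12 : Integrable (fun t => 2 * ((max (1 - t / (τ / 2)) 0) ^ 2 * C t) - 9 * ((max (1 - t / (3 * τ / 4)) 0) ^ 2 * C t))
      (volume.restrict (Ioc (0:ℝ) τ)) := i1.sub i2
  rw [setIntegral_congr_fun measurableSet_Ioc (fun t _ => hpt t), integral_add i12 i3, integral_sub i1 i2,
    integral_const_mul, integral_const_mul, integral_const_mul,
    riesz_piece hC (by positivity) (by linarith), riesz_piece hC (by positivity) (by linarith),
    riesz_piece hC hτ le_rfl]

/-! ## The early bulk window lemma (NEW real analysis; replaces the zero-mean window lemma + K4) -/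

/-- **Early bulk window lemma.** For `C` measurable with `|C| ≤ M` whose order-2 Riesz means `∫₀^τ (1−t/τ)² C → Λ`
(`τ → ∞`) and whose Abel means `∫₀^∞ e^{−νt} C → Λ` (`ν ↓ 0`) have a COMMON finite limit: for every `ε > 0` there is
`ν₁ > 0` such that for every `ν ∈ (0, ν₁]` there is `τ₁` with `|∫₀^τ χ(t/τ)(1 − e^{−νt}) C(t) dt| ≤ ε` for all `τ ≥ τ₁`
(`χ` the three-kernel Riesz window).  Proof: `∫₀^τ χ(t/τ)C = 2R₂(τ/2) − 9R₂(3τ/4) + 8R₂(τ) → Λ`, while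
`|∫₀^τ χ(t/τ)e^{−νt}C − A(ν)| ≤ 8M/(ν²τ) + 2M/(ν³τ)` because `χ(t/τ) = 1` for `t ≤ τ/2`. [folklore] -/
theorem early_bulk_window (χ : ℝ → ℝ)
    (hχ : ∀ s, χ s = 2 * (max (1 - 2 * s) 0) ^ 2 - 9 * (max (1 - 4 * s / 3) 0) ^ 2 + 8 * (max (1 - s) 0) ^ 2)
    (C : ℝ → ℝ) (M Λ : ℝ) (hCm : Measurable C) (hM : ∀ t, |C t| ≤ M)
    (hR : Tendsto (fun τ : ℝ => ∫ t in Ioc (0:ℝ) τ, (1 - t / τ) ^ 2 * C t) atTop (𝓝 Λ))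
    (hA : Tendsto (fun ν : ℝ => ∫ t in Ioi (0:ℝ), Real.exp (-(ν * t)) * C t) (𝓝[>] 0) (𝓝 Λ)) :
    ∀ ε : ℝ, 0 < ε → ∃ ν₁ : ℝ, 0 < ν₁ ∧ ∀ ν : ℝ, 0 < ν → ν ≤ ν₁ → ∃ τ₁ : ℝ, 0 < τ₁ ∧ ∀ τ : ℝ, τ₁ ≤ τ →
      |∫ t in Ioc (0:ℝ) τ, (χ (t / τ) * (1 - Real.exp (-(ν * t)))) * C t| ≤ ε := by
  intro ε hε
  have hM0 : 0 ≤ M := (abs_nonneg _).trans (hM 0)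
  have hχI : ∀ s, χ s ∈ Icc (0:ℝ) 1 := window_mem_Icc χ hχ
  have hχcont : Continuous χ := (window_continuous_antitone χ hχ).1
  -- Abel: `|A(ν) − Λ| < ε/3` for `0 < ν ≤ ν₁`
  obtain ⟨δ, hδ, hAδ⟩ := (Metric.tendsto_nhdsWithin_nhds.1 hA) (ε / 3) (by positivity)
  refine ⟨δ / 2, by positivity, fun ν hν hνle => ?_⟩
  set A : ℝ := ∫ t in Ioi (0:ℝ), Real.exp (-(ν * t)) * C t with hA_def
  have hAν : |A - Λ| < ε / 3 := by
    have h := @hAδ ν (show ν ∈ Ioi (0:ℝ) from hν) (by rw [dist_zero_right, Real.norm_eq_abs, abs_of_pos hν]; linarith)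
    rwa [Real.dist_eq] at h
  -- Riesz: the three-kernel combination tends to `Λ`
  set R : ℝ → ℝ := fun T => ∫ t in Ioc (0:ℝ) T, (1 - t / T) ^ 2 * C t with hR_def
  have h2 : Tendsto (fun τ : ℝ => R (τ / 2)) atTop (𝓝 Λ) := hR.comp (Tendsto.atTop_div_const (by norm_num) tendsto_id)
  have h34 : Tendsto (fun τ : ℝ => R (3 * τ / 4)) atTop (𝓝 Λ) :=
    hR.comp (Tendsto.atTop_div_const (by norm_num) (Tendsto.const_mul_atTop (by norm_num) tendsto_id))
  have hcomb : Tendsto (fun τ : ℝ => 2 * R (τ / 2) - 9 * R (3 * τ / 4) + 8 * R τ) atTop (𝓝 (2 * Λ - 9 * Λ + 8 * Λ)) :=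
    ((h2.const_mul 2).sub (h34.const_mul 9)).add (hR.const_mul 8)
  rw [show 2 * Λ - 9 * Λ + 8 * Λ = Λ by ring] at hcomb
  obtain ⟨τa, hτa⟩ := (Metric.tendsto_atTop.1 hcomb) (ε / 3) (by positivity)
  -- the exponential error threshold
  set τb : ℝ := 48 * (M + 1) / (ε * ν ^ 2) + 48 * (M + 1) / (ε * ν ^ 3) with hτb_def
  have hτb0 : 0 < τb := by positivity
  refine ⟨max (max τa τb) 1, lt_max_of_lt_right one_pos, fun τ hτ => ?_⟩
  have hτa' : τa ≤ τ := le_trans (le_trans (le_max_left _ _) (le_max_left _ _)) hτ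
  have hτb' : τb ≤ τ := le_trans (le_trans (le_max_right _ _) (le_max_left _ _)) hτ
  have hτ1 : (1:ℝ) ≤ τ := le_trans (le_max_right _ _) hτ
  have hτ0 : 0 < τ := by linarith
  -- integrability facts
  have hCint : IntegrableOn C (Ioc 0 τ) := integrableOn_Ioc_of_bounded hCm hM 0 τ
  have hexpint : ∀ a : ℝ, IntegrableOn (fun t : ℝ => Real.exp (-(ν * t))) (Ioi a) := fun a => by
    have h := exp_neg_integrableOn_Ioi a hν
    refine h.congr_fun (fun t _ => ?_) measurableSet_Ioi
    show Real.exp (-ν * t) = Real.exp (-(ν * t))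
    rw [neg_mul]
  have heC : ∀ a : ℝ, IntegrableOn (fun t : ℝ => Real.exp (-(ν * t)) * C t) (Ioi a) := fun a => by
    have h := Integrable.bdd_mul (hexpint a) hCm.aestronglyMeasurable (c := M)
      (Eventually.of_forall fun t => by rw [Real.norm_eq_abs]; exact hM t)
    exact h.congr (Eventually.of_forall fun t => mul_comm _ _)
  have hχτcont : Continuous fun t : ℝ => χ (t / τ) := hχcont.comp (continuous_id.div_const _)
  have hχC : IntegrableOn (fun t => χ (t / τ) * C t) (Ioc 0 τ) := by
    refine Integrable.bdd_mul hCint hχτcont.aestronglyMeasurable (c := 1) ?_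
    exact Eventually.of_forall fun t => by
      rw [Real.norm_eq_abs, abs_of_nonneg (hχI _).1]; exact (hχI _).2
  have hχeC : IntegrableOn (fun t => χ (t / τ) * (Real.exp (-(ν * t)) * C t)) (Ioc 0 τ) := by
    refine Integrable.bdd_mul ((heC 0).mono_set Ioc_subset_Ioi_self) hχτcont.aestronglyMeasurable (c := 1) ?_
    exact Eventually.of_forall fun t => by
      rw [Real.norm_eq_abs, abs_of_nonneg (hχI _).1]; exact (hχI _).2
  -- split the window integral: `∫ χ(1−e)C = ∫ χ C − ∫ χ e C`
  have hsplit : ∫ t in Ioc (0:ℝ) τ, (χ (t / τ) * (1 - Real.exp (-(ν * t)))) * C t =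
      (∫ t in Ioc (0:ℝ) τ, χ (t / τ) * C t) - ∫ t in Ioc (0:ℝ) τ, χ (t / τ) * (Real.exp (-(ν * t)) * C t) := by
    rw [← integral_sub hχC hχeC]
    refine integral_congr_ae (ae_of_all _ fun t => ?_)
    ring
  -- (a) the Riesz identification
  have hTχ : ∫ t in Ioc (0:ℝ) τ, χ (t / τ) * C t = 2 * R (τ / 2) - 9 * R (3 * τ / 4) + 8 * R τ := by
    simp only [hR_def]
    exact window_riesz_decomp χ hχ hCm hM hτ0
  have hTχ_bd : |(∫ t in Ioc (0:ℝ) τ, χ (t / τ) * C t) - Λ| < ε / 3 := by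
    rw [hTχ, ← Real.dist_eq]; exact hτa τ hτa'
  -- (b) the Abel identification up to an exponentially small error
  have hA_split : A = (∫ t in Ioc (0:ℝ) τ, Real.exp (-(ν * t)) * C t) + ∫ t in Ioi τ, Real.exp (-(ν * t)) * C t := by
    simp only [hA_def]
    rw [← Ioc_union_Ioi_eq_Ioi hτ0.le, setIntegral_union (Ioc_disjoint_Ioi le_rfl) measurableSet_Ioi
      ((heC 0).mono_set Ioc_subset_Ioi_self) ((heC 0).mono_set (Ioi_subset_Ioi hτ0.le))]
  have hy : 0 < ν * τ / 2 := by positivity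
  have hexp_half : Real.exp (-(ν * τ / 2)) ≤ 8 / (ν ^ 2 * τ ^ 2) := by
    have h : Real.exp (-(ν * τ / 2)) ≤ 2 / (ν * τ / 2) ^ 2 := by
      -- `e^{−y} ≤ 2/y²` for `y > 0` (from `1 + y + y²/2 ≤ e^y`)
      have hq := Real.quadratic_le_exp_of_nonneg hy.le
      have hy2 : 0 < (ν * τ / 2) ^ 2 / 2 := by positivity
      have h' : (ν * τ / 2) ^ 2 / 2 ≤ Real.exp (ν * τ / 2) := by linarith
      rw [Real.exp_neg, show (2 : ℝ) / (ν * τ / 2) ^ 2 = ((ν * τ / 2) ^ 2 / 2)⁻¹ by rw [inv_div]]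
      exact inv_anti₀ hy2 h'
    calc Real.exp (-(ν * τ / 2)) ≤ 2 / (ν * τ / 2) ^ 2 := h
      _ = 8 / (ν ^ 2 * τ ^ 2) := by field_simp; ring
  -- part 1: `|∫_{(0,τ]} (χ(t/τ) − 1) e^{−νt} C| ≤ M e^{−ντ/2} τ ≤ 8M/(ν²τ)`
  have hpart1 : |(∫ t in Ioc (0:ℝ) τ, χ (t / τ) * (Real.exp (-(ν * t)) * C t)) -
      ∫ t in Ioc (0:ℝ) τ, Real.exp (-(ν * t)) * C t| ≤ 8 * M / (ν ^ 2 * τ) := by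
    rw [← integral_sub hχeC ((heC 0).mono_set Ioc_subset_Ioi_self)]
    have hbound : ∀ t ∈ Ioc (0:ℝ) τ, ‖χ (t / τ) * (Real.exp (-(ν * t)) * C t) - Real.exp (-(ν * t)) * C t‖ ≤
        M * Real.exp (-(ν * τ / 2)) := by
      intro t ht
      rw [Real.norm_eq_abs, show χ (t / τ) * (Real.exp (-(ν * t)) * C t) - Real.exp (-(ν * t)) * C t =
        (χ (t / τ) - 1) * (Real.exp (-(ν * t)) * C t) by ring]
      by_cases hth : t ≤ τ / 2
      · have h1 : χ (t / τ) = 1 := window_eq_one χ hχ (by rw [div_le_iff₀ hτ0]; linarith)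
        rw [h1, sub_self, zero_mul, abs_zero]; positivity
      · push Not at hth
        rw [abs_mul, abs_mul, abs_of_pos (Real.exp_pos _)]
        have hχ1 : |χ (t / τ) - 1| ≤ 1 := by
          rw [abs_sub_comm, abs_of_nonneg (by linarith [(hχI (t / τ)).2])]; linarith [(hχI (t / τ)).1]
        have he : Real.exp (-(ν * t)) ≤ Real.exp (-(ν * τ / 2)) := Real.exp_le_exp.2 (by nlinarith)
        calc |χ (t / τ) - 1| * (Real.exp (-(ν * t)) * |C t|) ≤ 1 * (Real.exp (-(ν * τ / 2)) * M) := by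
              gcongr
              exact hM t
          _ = M * Real.exp (-(ν * τ / 2)) := by ring
    have h := norm_setIntegral_le_of_norm_le_const (measure_Ioc_lt_top (μ := (volume : Measure ℝ))) hbound
    rw [Real.norm_eq_abs, Real.volume_real_Ioc_of_le hτ0.le, sub_zero] at h
    calc |∫ t in Ioc (0:ℝ) τ, χ (t / τ) * (Real.exp (-(ν * t)) * C t) - Real.exp (-(ν * t)) * C t|
        ≤ M * Real.exp (-(ν * τ / 2)) * τ := h
      _ ≤ M * (8 / (ν ^ 2 * τ ^ 2)) * τ := by gcongr
      _ = 8 * M / (ν ^ 2 * τ) := by field_simp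
  -- part 2: the tail `|∫_{(τ,∞)} e^{−νt} C| ≤ M e^{−ντ}/ν ≤ 8M/(ν³τ)`
  have hpart2 : |∫ t in Ioi τ, Real.exp (-(ν * t)) * C t| ≤ 8 * M / (ν ^ 3 * τ) := by
    have hg : IntegrableOn (fun t : ℝ => M * Real.exp (-(ν * t))) (Ioi τ) := (hexpint τ).const_mul M
    have hle : ∀ᵐ t ∂(volume.restrict (Ioi τ)), ‖Real.exp (-(ν * t)) * C t‖ ≤ M * Real.exp (-(ν * t)) :=
      Eventually.of_forall fun t => by
        rw [Real.norm_eq_abs, abs_mul, abs_of_pos (Real.exp_pos _), mul_comm]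
        exact mul_le_mul_of_nonneg_right (hM t) (Real.exp_pos _).le
    have h := norm_integral_le_of_norm_le hg hle
    rw [Real.norm_eq_abs] at h
    have hval : ∫ t in Ioi τ, M * Real.exp (-(ν * t)) = M * (Real.exp (-(ν * τ)) / ν) := by
      rw [integral_const_mul]
      congr 1
      have h' := integral_exp_mul_Ioi (show -ν < 0 by linarith) τ
      have h'' : ∫ t in Ioi τ, Real.exp (-(ν * t)) = ∫ t in Ioi τ, Real.exp (-ν * t) :=
        setIntegral_congr_fun measurableSet_Ioi (fun t _ => by rw [neg_mul])
      rw [h'', h', neg_mul]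
      field_simp
    rw [hval] at h
    have hexp_full : Real.exp (-(ν * τ)) ≤ Real.exp (-(ν * τ / 2)) := Real.exp_le_exp.2 (by nlinarith)
    have hττ : τ ≤ τ ^ 2 := by nlinarith
    have hτsq : ν ^ 3 * τ ≤ ν ^ 3 * τ ^ 2 := mul_le_mul_of_nonneg_left hττ (pow_pos hν 3).le
    calc |∫ t in Ioi τ, Real.exp (-(ν * t)) * C t| ≤ M * (Real.exp (-(ν * τ)) / ν) := h
      _ ≤ M * ((8 / (ν ^ 2 * τ ^ 2)) / ν) := by gcongr; exact hexp_full.trans hexp_half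
      _ = 8 * M / (ν ^ 3 * τ ^ 2) := by field_simp
      _ ≤ 8 * M / (ν ^ 3 * τ) := div_le_div_of_nonneg_left (by positivity) (by positivity) hτsq
  -- the two error terms are `≤ ε/6` each, by the choice of `τb`
  have hA1 : 48 * (M + 1) / (ε * ν ^ 2) ≤ τ := le_trans (le_add_of_nonneg_right (by positivity)) hτb'
  have hA2 : 48 * (M + 1) / (ε * ν ^ 3) ≤ τ := le_trans (le_add_of_nonneg_left (by positivity)) hτb'
  rw [div_le_iff₀ (by positivity)] at hA1 hA2
  have herr1 : 8 * M / (ν ^ 2 * τ) ≤ ε / 6 := by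
    rw [div_le_iff₀ (by positivity)]
    have : ε / 6 * (ν ^ 2 * τ) = τ * (ε * ν ^ 2) / 6 := by ring
    rw [this]; linarith
  have herr2 : 8 * M / (ν ^ 3 * τ) ≤ ε / 6 := by
    rw [div_le_iff₀ (by positivity)]
    have : ε / 6 * (ν ^ 3 * τ) = τ * (ε * ν ^ 3) / 6 := by ring
    rw [this]; linarith
  -- assemble
  set X : ℝ := ∫ t in Ioc (0:ℝ) τ, χ (t / τ) * C t with hX
  set Y : ℝ := ∫ t in Ioc (0:ℝ) τ, χ (t / τ) * (Real.exp (-(ν * t)) * C t) with hY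
  set Z : ℝ := ∫ t in Ioc (0:ℝ) τ, Real.exp (-(ν * t)) * C t with hZ
  set V : ℝ := ∫ t in Ioi τ, Real.exp (-(ν * t)) * C t with hV
  have hAY : |A - Y| ≤ ε / 6 + ε / 6 := by
    rw [abs_sub_comm, show Y - A = (Y - Z) - V by rw [hA_split]; ring]
    calc |(Y - Z) - V| ≤ |Y - Z| + |V| := abs_sub _ _
      _ ≤ 8 * M / (ν ^ 2 * τ) + 8 * M / (ν ^ 3 * τ) := add_le_add hpart1 hpart2
      _ ≤ ε / 6 + ε / 6 := add_le_add herr1 herr2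
  rw [hsplit]
  calc |X - Y| = |(X - Λ) + (Λ - A) + (A - Y)| := by ring_nf
    _ ≤ |X - Λ| + |Λ - A| + |A - Y| := abs_add_three _ _ _
    _ ≤ ε / 3 + ε / 3 + (ε / 6 + ε / 6) :=
        add_le_add (add_le_add hTχ_bd.le (by rw [abs_sub_comm]; exact hAν.le)) hAY
    _ = ε := by ring


/-! ## Registered form -/

/-- **Registered analysis stub `stub_earlyBulkWindow` of line `Sketch` (crux stmt-AtomisticToContinuum-13416)** — the early bulk
window lemma in closed `∀`-form (see `early_bulk_window`). [folklore] -/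
theorem stub_earlyBulkWindow :
    ∀ (χ : ℝ → ℝ), (∀ s, χ s = 2 * (max (1 - 2 * s) 0) ^ 2 - 9 * (max (1 - 4 * s / 3) 0) ^ 2 + 8 * (max (1 - s) 0) ^ 2) → ∀ (C : ℝ → ℝ) (M Λ : ℝ), Measurable C → (∀ t, |C t| ≤ M) → Filter.Tendsto (fun τ : ℝ => ∫ t in Set.Ioc (0:ℝ) τ, (1 - t / τ) ^ 2 * C t) Filter.atTop (nhds Λ) → Filter.Tendsto (fun ν : ℝ => ∫ t in Set.Ioi (0:ℝ), Real.exp (-(ν * t)) * C t) (nhdsWithin (0:ℝ) (Set.Ioi 0)) (nhds Λ) → ∀ ε : ℝ, 0 < ε → ∃ ν₁ : ℝ, 0 < ν₁ ∧ ∀ ν : ℝ, 0 < ν → ν ≤ ν₁ → ∃ τ₁ : ℝ, 0 < τ₁ ∧ ∀ τ : ℝ, τ₁ ≤ τ → |∫ t in Set.Ioc (0:ℝ) τ, (χ (t / τ) * (1 - Real.exp (-(ν * t)))) * C t| ≤ ε :=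
  fun χ hχ C M Λ hCm hM hR hA => early_bulk_window χ hχ C M Λ hCm hM hR hA

end Summit.AtomisticToContinuum.FouriersLaw.Theorems.UniformAbelianRegularity.AbelSummableSplice

end
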